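import Summits.QuantumFields.YangMills.Theses.ConvexGribovBody
import Literature.MathematicalPhysics.QuantumFieldTheory.LatticeGaugeProofs
import Literature.MathematicalPhysics.QuantumFieldTheory.ConstructiveQFTWave0OddRPProofs

/-!
# Layer autocovariances are non-negative, even and log-convex
(crux `ConvexGribovBody.PoincareToGap`, line `Sketch`, stub F4 `stub_cov_nonneg_logConvex`)

On the odd torus `(ℤ/(2S+1))⁴`, `S ≥ 1`, with Wilson's measure `μ = wilsonMeasure r.ρ β`, `β ≥ 0`,
let `A` be a bounded measurable observable reading only the SPATIAL links of the time-zero slice,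
`T_v := torusConfigShift v`, `raw n := ∫ A · (A ∘ T_{n e₀}) dμ`, `m := ∫ A dμ`, `c n := raw n - m²`
(`n : ZMod (2S+1)`). We prove (I) `0 ≤ c n`; (II) `raw (-n) = raw n`; (III)
`c n ^ 2 ≤ c (n-1) c (n+1)` for `n ≠ 0`. Translation invariance of `μ` gives the stationarity
`∫ (f ∘ T_v)(g ∘ T_w) dμ = ∫ f (g ∘ T_{w-v}) dμ`, whence (II) and, for the centred layer copies
`B_t := A ∘ T_{-t e₀} - m` (spatial links of the slice `t`), `∫ B_s B_t dμ = c (s - t)`. Wave 0's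
reflection `θ t = 1 - t` satisfies `B_t ∘ Θ = B_{1-t}`, and `B_t` reads `oPosEdges ∪ oSharedEdges`
for `1 ≤ t ≤ S + 1`; reflection positivity of the odd torus
(`wilsonExpectation_oddReflectionPositive`) applied to `a B_s + b B_t` yields the Hankel positivity
`0 ≤ a² c(1-2s) + 2ab c(1-s-t) + b² c(1-2t)`. Diagonal terms and `2 × 2` minors (`discrim_le_zero`)
give `c(2j-1) ≥ 0` (`1 ≤ j ≤ S+1`), `c(2j)² ≤ c(2j-1) c(2j+1)` (`1 ≤ j ≤ S`); evenness does the rest.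
References: K. Osterwalder, E. Seiler, Ann. Phys. 110 (1978) 440, §2; E. Seiler, LNP 159 (1982),
Ch. 2; J. Fröhlich, R. Israel, E. Lieb, B. Simon, Comm. Math. Phys. 62 (1978) 1. [folklore]
-/

noncomputable section

open scoped BigOperators Topology ComplexOrder
open MeasureTheory Filter
open Literature.MathematicalPhysics.QuantumFieldTheory

namespace Summit.QuantumFields.YangMills.Theorems.PoincareToGap

/-- Expansion of `∫ (a f₁ + b f₂)(a g₁ + b g₂) dμ` into the four mixed integrals. [folklore] -/
theorem covLC_integral_lin_mul_lin {X : Type*} [MeasurableSpace X] {μ : Measure X}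
    {f₁ f₂ g₁ g₂ : X → ℝ} (h11 : Integrable (fun x => f₁ x * g₁ x) μ)
    (h12 : Integrable (fun x => f₁ x * g₂ x) μ) (h21 : Integrable (fun x => f₂ x * g₁ x) μ)
    (h22 : Integrable (fun x => f₂ x * g₂ x) μ) (a b : ℝ) :
    ∫ x, (a * f₁ x + b * f₂ x) * (a * g₁ x + b * g₂ x) ∂μ =
      a ^ 2 * ∫ x, f₁ x * g₁ x ∂μ + a * b * ∫ x, f₁ x * g₂ x ∂μ +
        a * b * ∫ x, f₂ x * g₁ x ∂μ + b ^ 2 * ∫ x, f₂ x * g₂ x ∂μ := by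
  have i1 : Integrable (fun x => a ^ 2 * (f₁ x * g₁ x)) μ := h11.const_mul _
  have i2 : Integrable (fun x => a * b * (f₁ x * g₂ x)) μ := h12.const_mul _
  have i3 : Integrable (fun x => a * b * (f₂ x * g₁ x)) μ := h21.const_mul _
  have i4 : Integrable (fun x => b ^ 2 * (f₂ x * g₂ x)) μ := h22.const_mul _
  have i12 : Integrable (fun x => a ^ 2 * (f₁ x * g₁ x) + a * b * (f₁ x * g₂ x)) μ := i1.add i2
  have i123 : Integrable (fun x => a ^ 2 * (f₁ x * g₁ x) + a * b * (f₁ x * g₂ x) +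
      a * b * (f₂ x * g₁ x)) μ := i12.add i3
  rw [← integral_const_mul, ← integral_const_mul, ← integral_const_mul, ← integral_const_mul,
    ← integral_add i1 i2, ← integral_add i12 i3, ← integral_add i123 i4]
  congr 1; funext x; ring

/-- A non-negative binary quadratic form `p a² + 2 q a b + r b²` has `q² ≤ p r`. [folklore] -/
theorem covLC_sq_le_mul {p q r : ℝ}
    (h : ∀ a b : ℝ, 0 ≤ a ^ 2 * p + 2 * a * b * q + b ^ 2 * r) : q ^ 2 ≤ p * r := by
  have hd := discrim_le_zero (K := ℝ) (a := p) (b := 2 * q) (c := r) fun x => by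
    linarith [h x 1]
  rw [discrim] at hd
  nlinarith [hd]

/-- **Odd-cycle bookkeeping.** On `ZMod (2S+1)`, `S ≥ 1`: if `c` is even and the Hankel forms
`a² c(1-2s) + 2ab c(1-s-t) + b² c(1-2t)` are non-negative for `1 ≤ s, t ≤ S + 1`, then `c ≥ 0`
everywhere and `c(n)² ≤ c(n-1) c(n+1)` for `n ≠ 0` (diagonal terms give the odd residues and `0`,
the minors `{j, j+1}` the even ones, evenness `c(-n) = c(n)` the rest). [folklore] -/
theorem covLC_bookkeeping (S : ℕ) (hS : 1 ≤ S) (c : ZMod (2 * S + 1) → ℝ)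
    (heven : ∀ n, c (-n) = c n)
    (hH : ∀ s t : ZMod (2 * S + 1), 1 ≤ s.val → s.val ≤ S + 1 → 1 ≤ t.val → t.val ≤ S + 1 →
      ∀ a b : ℝ, 0 ≤ a ^ 2 * c (1 - 2 * s) + 2 * a * b * c (1 - s - t) + b ^ 2 * c (1 - 2 * t)) :
    (∀ n, 0 ≤ c n) ∧ (∀ n, n ≠ 0 → c n ^ 2 ≤ c (n - 1) * c (n + 1)) := by
  have hval : ∀ j : ℕ, j ≤ S + 1 → (j : ZMod (2 * S + 1)).val = j := fun j hj =>
    ZMod.val_cast_of_lt (by omega)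
  have hL0 : (2 : ZMod (2 * S + 1)) * (S : ZMod (2 * S + 1)) + 1 = 0 := by
    have h := ZMod.natCast_self (2 * S + 1); push_cast at h; exact h
  have hdiag : ∀ j : ℕ, 1 ≤ j → j ≤ S + 1 → 0 ≤ c (2 * (j : ZMod (2 * S + 1)) - 1) := by
    intro j hj hj'
    have hv : (j : ZMod (2 * S + 1)).val = j := hval j hj'
    have h := hH j j (by rw [hv]; exact hj) (by rw [hv]; exact hj') (by rw [hv]; exact hj)
      (by rw [hv]; exact hj') 1 0
    rw [show (1 : ZMod (2 * S + 1)) - 2 * (j : ZMod (2 * S + 1)) =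
      -(2 * (j : ZMod (2 * S + 1)) - 1) by ring, heven] at h
    linarith
  have hminor : ∀ j : ℕ, 1 ≤ j → j ≤ S → c (2 * (j : ZMod (2 * S + 1))) ^ 2 ≤
      c (2 * (j : ZMod (2 * S + 1)) - 1) * c (2 * (j : ZMod (2 * S + 1)) + 1) := by
    intro j hj hj'
    have hv1 : (j : ZMod (2 * S + 1)).val = j := hval j (by omega)
    have hv2 : ((j + 1 : ℕ) : ZMod (2 * S + 1)).val = j + 1 := hval (j + 1) (by omega)
    have h := hH j ((j + 1 : ℕ) : ZMod (2 * S + 1)) (by rw [hv1]; exact hj) (by rw [hv1]; omega)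
      (by rw [hv2]; omega) (by rw [hv2]; omega)
    have e1 : (1 : ZMod (2 * S + 1)) - 2 * (j : ZMod (2 * S + 1)) =
        -(2 * (j : ZMod (2 * S + 1)) - 1) := by ring
    have e2 : (1 : ZMod (2 * S + 1)) - (j : ZMod (2 * S + 1)) - ((j + 1 : ℕ) : ZMod (2 * S + 1)) =
        -(2 * (j : ZMod (2 * S + 1))) := by push_cast; ring
    have e3 : (1 : ZMod (2 * S + 1)) - 2 * ((j + 1 : ℕ) : ZMod (2 * S + 1)) =
        -(2 * (j : ZMod (2 * S + 1)) + 1) := by push_cast; ring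
    simp only [e1, e2, e3, heven] at h
    exact covLC_sq_le_mul h
  refine ⟨fun n => ?_, fun n hn => ?_⟩
  · have hv := ZMod.val_lt n
    obtain ⟨j, hj | hj⟩ := Nat.even_or_odd' n.val
    · rcases Nat.eq_zero_or_pos j with rfl | hjpos
      · have hn : n = 2 * ((S + 1 : ℕ) : ZMod (2 * S + 1)) - 1 := by
          rw [← ZMod.natCast_zmod_val n, hj]; push_cast
          linear_combination (-1 : ZMod (2 * S + 1)) * hL0
        rw [hn]
        exact hdiag (S + 1) (by omega) le_rfl
      · have hjS : j ≤ S := by omega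
        have hn : n = -(2 * ((S - j + 1 : ℕ) : ZMod (2 * S + 1)) - 1) := by
          rw [← ZMod.natCast_zmod_val n, hj]; push_cast [Nat.cast_sub hjS]
          linear_combination hL0
        rw [hn, heven]
        exact hdiag (S - j + 1) (by omega) (by omega)
    · have hn : n = 2 * ((j + 1 : ℕ) : ZMod (2 * S + 1)) - 1 := by
        rw [← ZMod.natCast_zmod_val n, hj]; push_cast; ring
      rw [hn]
      exact hdiag (j + 1) (by omega) (by omega)
  · have hv := ZMod.val_lt n
    have hn0 : n.val ≠ 0 := fun h => hn ((ZMod.val_eq_zero n).1 h)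
    obtain ⟨j, hj | hj⟩ := Nat.even_or_odd' n.val
    · have hn' : n = 2 * (j : ZMod (2 * S + 1)) := by
        rw [← ZMod.natCast_zmod_val n, hj]; push_cast; ring
      rw [hn']
      exact hminor j (by omega) (by omega)
    · have hjS : j ≤ S := by omega
      have hn' : n = -(2 * ((S - j : ℕ) : ZMod (2 * S + 1))) := by
        rw [← ZMod.natCast_zmod_val n, hj]; push_cast [Nat.cast_sub hjS]
        linear_combination hL0
      have h := hminor (S - j) (by omega) (by omega)
      rw [hn', heven,
        show -(2 * ((S - j : ℕ) : ZMod (2 * S + 1))) - 1 =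
          -(2 * ((S - j : ℕ) : ZMod (2 * S + 1)) + 1) by ring, heven,
        show -(2 * ((S - j : ℕ) : ZMod (2 * S + 1))) + 1 =
          -(2 * ((S - j : ℕ) : ZMod (2 * S + 1)) - 1) by ring, heven]
      linarith

section Shift

variable {d L : ℕ} {G : Type*} [MeasurableSpace G]

/-- Torus translations compose: `T_v (T_w U) = T_{v+w} U`. [folklore] -/
theorem covLC_shift_shift (v w : Site d L) (U : GaugeConfig d L G) :
    torusConfigShift v (torusConfigShift w U) = torusConfigShift (v + w) U := by
  funext e
  simp only [torusConfigShift_apply, sub_sub]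

/-- The translation by `0` is the identity. [folklore] -/
theorem covLC_shift_zero (U : GaugeConfig d L G) : torusConfigShift (0 : Site d L) U = U := by
  funext e
  simp only [torusConfigShift_apply, sub_zero, Prod.mk.eta]

end Shift

section Stationarity

variable {d L N : ℕ} [NeZero L] {G : Type*} [Group G] [TopologicalSpace G] [IsTopologicalGroup G]
  [CompactSpace G] [MeasurableSpace G] [BorelSpace G] (ρ : G →* Matrix (Fin N) (Fin N) ℂ) (β : ℝ)
  {μ : Measure (GaugeConfig d L G)}

/-- Translation invariance of expectations: `∫ f ∘ T_v dμ = ∫ f dμ`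
(`wilsonExpectation_comp_torusConfigShift`). [folklore] -/
theorem covLC_integral_comp_shift (hμ : μ = wilsonMeasure ρ β) {E : Type*} [NormedAddCommGroup E]
    [NormedSpace ℝ E] (v : Site d L) (f : GaugeConfig d L G → E) :
    ∫ U, f (torusConfigShift v U) ∂μ = ∫ U, f U ∂μ := by
  subst hμ
  exact wilsonExpectation_comp_torusConfigShift ρ β v f

/-- Stationarity of two-point functions: `∫ (f ∘ T_v)(g ∘ T_w) dμ = ∫ f (g ∘ T_{w-v}) dμ`.
[folklore] -/
theorem covLC_integral_comp_shift_mul_comp_shift (hμ : μ = wilsonMeasure ρ β)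
    (f g : GaugeConfig d L G → ℝ) (v w : Site d L) :
    ∫ U, f (torusConfigShift v U) * g (torusConfigShift w U) ∂μ =
      ∫ U, f U * g (torusConfigShift (w - v) U) ∂μ := by
  subst hμ
  conv_rhs => rw [← wilsonMeasure_map_torusConfigShift ρ β v, integral_map_equiv]
  simp only [covLC_shift_shift, sub_add_cancel]

/-- Stationarity, one-sided form: `∫ (f ∘ T_v) g dμ = ∫ f (g ∘ T_{-v}) dμ`. [folklore] -/
theorem covLC_integral_comp_shift_mul (hμ : μ = wilsonMeasure ρ β) (f g : GaugeConfig d L G → ℝ)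
    (v : Site d L) :
    ∫ U, f (torusConfigShift v U) * g U ∂μ = ∫ U, f U * g (torusConfigShift (-v) U) ∂μ := by
  have h := covLC_integral_comp_shift_mul_comp_shift ρ β hμ f g v 0
  simp only [covLC_shift_zero, zero_sub] at h
  exact h

/-- Covariance of two translated copies of a bounded observable in terms of the autocovariance:
`∫ (A ∘ T_v - m)(A ∘ T_w - m) dμ = ∫ A (A ∘ T_{w-v}) dμ - m²` for `m = ∫ A dμ`. [folklore] -/
theorem covLC_integral_centred_mul_centred (hμ : μ = wilsonMeasure ρ β) (hρ : Continuous ρ)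
    (A : GaugeConfig d L G → ℝ) (hAm : Measurable A) {M : ℝ} (hM : ∀ U, |A U| ≤ M) (m : ℝ)
    (hm : ∫ V, A V ∂μ = m) (v w : Site d L) :
    ∫ U, (A (torusConfigShift v U) - m) * (A (torusConfigShift w U) - m) ∂μ =
      ∫ U, A U * A (torusConfigShift (w - v) U) ∂μ - m * m := by
  haveI : IsProbabilityMeasure μ := hμ ▸ isProbabilityMeasure_wilsonMeasure (d := d) (L := L) ρ hρ β
  have hX : ∫ U, A (torusConfigShift v U) ∂μ = m := (covLC_integral_comp_shift ρ β hμ v A).trans hm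
  have hY : ∫ U, A (torusConfigShift w U) ∂μ = m := (covLC_integral_comp_shift ρ β hμ w A).trans hm
  have mX : MemLp (fun U => A (torusConfigShift v U)) 2 μ :=
    MemLp.of_bound (hAm.comp (torusConfigShift v).measurable).aestronglyMeasurable M
      (ae_of_all _ fun U => by rw [Real.norm_eq_abs]; exact hM _)
  have mY : MemLp (fun U => A (torusConfigShift w U)) 2 μ :=
    MemLp.of_bound (hAm.comp (torusConfigShift w).measurable).aestronglyMeasurable M
      (ae_of_all _ fun U => by rw [Real.norm_eq_abs]; exact hM _)
  have h := ProbabilityTheory.covariance_eq_sub mX mY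
  simp only [ProbabilityTheory.covariance, hX, hY, Pi.mul_apply] at h
  rw [h, covLC_integral_comp_shift_mul_comp_shift ρ β hμ]

end Stationarity

section Layer

variable {d L : ℕ} [NeZero d] {G : Type*} [Group G] [MeasurableSpace G]
  {A : GaugeConfig d L G → ℝ} (hAd : DependsOn A {e : Edge d L | e.1 0 = 0 ∧ e.2 ≠ 0})
include hAd

/-- Reflection of the layer copies: `A ∘ T_{-t e₀} ∘ Θ = A ∘ T_{-(1-t) e₀}` — the reflection
`θ s = 1 - s` carries the spatial links of the slice `t` to those of the slice `1 - t`, and `A`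
ignores temporal links. [folklore] -/
theorem covLC_layer_timeReflect (t : ZMod L) (U : GaugeConfig d L G) :
    A (torusConfigShift (Pi.single (0 : Fin d) (-t) : Site d L) U.timeReflect) =
      A (torusConfigShift (Pi.single (0 : Fin d) (-(1 - t)) : Site d L) U) := by
  refine hAd fun e he => ?_
  simp only [Set.mem_setOf_eq] at he
  obtain ⟨he0, hek⟩ := he
  have hsite : (e.1 - (Pi.single (0 : Fin d) (-t) : Site d L)).timeReflect =
      e.1 - (Pi.single (0 : Fin d) (-(1 - t)) : Site d L) := by
    funext k
    by_cases hk : k = 0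
    · subst hk
      rw [WilsonRP.timeReflect_apply_zero, Pi.sub_apply, Pi.sub_apply, Pi.single_eq_same,
        Pi.single_eq_same, he0]
      ring
    · rw [WilsonRP.timeReflect_apply_of_ne _ hk, Pi.sub_apply, Pi.sub_apply,
        Pi.single_eq_of_ne hk, Pi.single_eq_of_ne hk]
  simp only [torusConfigShift_apply, GaugeConfig.timeReflect, hek, hsite, if_false]

omit [Group G] in
/-- For `1 ≤ t ≤ L/2 + 1` the layer copy `A ∘ T_{-t e₀}` reads only positive or shared links of
the odd torus (`WilsonOddRP.oPosEdges`: base time in `[1, L/2]`; `WilsonOddRP.oSharedEdges`: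
spatial links of the slice `L/2 + 1`). [folklore] -/
theorem covLC_layer_dependsOn [NeZero L] {t : ZMod L} (ht : 1 ≤ t.val) (ht' : t.val ≤ L / 2 + 1) :
    DependsOn (fun U => A (torusConfigShift (Pi.single (0 : Fin d) (-t) : Site d L) U))
      ((WilsonOddRP.oPosEdges ∪ WilsonOddRP.oSharedEdges : Finset (Edge d L)) :
        Set (Edge d L)) := by
  intro U V hUV
  refine hAd fun e he => ?_
  simp only [Set.mem_setOf_eq] at he
  obtain ⟨he0, hek⟩ := he
  rw [torusConfigShift_apply, torusConfigShift_apply]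
  apply hUV
  have h0 : (e.1 - (Pi.single (0 : Fin d) (-t) : Site d L)) 0 = t := by
    rw [Pi.sub_apply, Pi.single_eq_same, he0, zero_sub, neg_neg]
  simp only [Finset.coe_union, Set.mem_union, Finset.mem_coe, WilsonOddRP.mem_oPosEdges,
    WilsonOddRP.mem_oSharedEdges, WilsonOddRP.IsOPosEdge, WilsonOddRP.IsOSharedEdge, h0]
  by_cases hle : t.val ≤ L / 2
  · exact Or.inl ⟨ht, hle⟩
  · exact Or.inr ⟨hek, by omega⟩

end Layer

section Hankel

variable {d L N : ℕ} [NeZero d] [NeZero L] {G : Type*} [Group G] [TopologicalSpace G]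
  [IsTopologicalGroup G] [CompactSpace G] [MeasurableSpace G] [BorelSpace G]
  (ρ : G →* Matrix (Fin N) (Fin N) ℂ) {μ : Measure (GaugeConfig d L G)}

/-- Reflection positivity of the odd torus (`wilsonExpectation_oddReflectionPositive`) for a
REAL bounded measurable observable `F` of `P ∪ M`: `0 ≤ ∫ F(ΘU) F(U) dμ`. [folklore] -/
theorem covLC_integral_timeReflect_mul_self_nonneg (hL : Odd L) (hL3 : 3 ≤ L)
    (hρ : Continuous ρ) {β : ℝ} (hβ : 0 ≤ β) (hμ : μ = wilsonMeasure ρ β)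
    (F : GaugeConfig d L G → ℝ) (hF : Measurable F) (hFb : ∃ C : ℝ, ∀ U, |F U| ≤ C)
    (hFdep : DependsOn F ((WilsonOddRP.oPosEdges ∪ WilsonOddRP.oSharedEdges :
      Finset (Edge d L)) : Set (Edge d L))) :
    0 ≤ ∫ U, F U.timeReflect * F U ∂μ := by
  subst hμ
  obtain ⟨C, hC⟩ := hFb
  have h := wilsonExpectation_oddReflectionPositive ρ hL hL3 hρ hβ (fun U => (F U : ℂ))
    (Complex.measurable_ofReal.comp hF)
    ⟨C, fun U => by rw [Complex.norm_real, Real.norm_eq_abs]; exact hC U⟩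
    (fun U V hUV => by
      show ((F U : ℝ) : ℂ) = F V
      rw [hFdep hUV])
  simp only [wilsonExpectation, Complex.conj_ofReal, ← Complex.ofReal_mul,
    integral_complex_ofReal] at h
  exact Complex.zero_le_real.1 h

/-- **Hankel positivity from reflection positivity.** Let `B_t` (`t : ZMod L`) be uniformly
bounded measurable real observables with `B_t ∘ Θ = B_{1-t}`, `B_t` reading only `P ∪ M` for
`1 ≤ t ≤ L/2 + 1`, and `∫ B_s B_t dμ = c (s - t)`. Then for `1 ≤ s, t ≤ L/2 + 1` and real `a, b`,
`0 ≤ a² c(1-2s) + 2ab c(1-s-t) + b² c(1-2t)` (RP applied to `a B_s + b B_t`). [folklore] -/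
theorem covLC_hankel_nonneg (hL : Odd L) (hL3 : 3 ≤ L) (hρ : Continuous ρ) {β : ℝ} (hβ : 0 ≤ β)
    (hμ : μ = wilsonMeasure ρ β) (B : ZMod L → GaugeConfig d L G → ℝ) (c : ZMod L → ℝ)
    (hBm : ∀ t, Measurable (B t)) {K : ℝ} (hBb : ∀ t U, |B t U| ≤ K)
    (hrefl : ∀ t U, B t U.timeReflect = B (1 - t) U)
    (hdep : ∀ t : ZMod L, 1 ≤ t.val → t.val ≤ L / 2 + 1 → DependsOn (B t)
      ((WilsonOddRP.oPosEdges ∪ WilsonOddRP.oSharedEdges : Finset (Edge d L)) : Set (Edge d L)))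
    (hcov : ∀ s t, ∫ U, B s U * B t U ∂μ = c (s - t)) {s t : ZMod L} (hs : 1 ≤ s.val)
    (hs' : s.val ≤ L / 2 + 1) (ht : 1 ≤ t.val) (ht' : t.val ≤ L / 2 + 1) (a b : ℝ) :
    0 ≤ a ^ 2 * c (1 - 2 * s) + 2 * a * b * c (1 - s - t) + b ^ 2 * c (1 - 2 * t) := by
  haveI : IsProbabilityMeasure μ := hμ ▸ isProbabilityMeasure_wilsonMeasure (d := d) (L := L) ρ hρ β
  have hbd : ∀ s' t' U, ‖B s' U * B t' U‖ ≤ K * K := fun s' t' U => by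
    rw [Real.norm_eq_abs, abs_mul]
    exact mul_le_mul (hBb s' U) (hBb t' U) (abs_nonneg _) ((abs_nonneg _).trans (hBb s' U))
  have hint : ∀ s' t', Integrable (fun U => B s' U * B t' U) μ := fun s' t' =>
    Integrable.of_bound ((hBm s').mul (hBm t')).aestronglyMeasurable (K * K)
      (ae_of_all _ (hbd s' t'))
  have h0 := covLC_integral_timeReflect_mul_self_nonneg ρ hL hL3 hρ hβ hμ
    (fun U => a * B s U + b * B t U) (((hBm s).const_mul a).add ((hBm t).const_mul b))
    ⟨|a| * K + |b| * K, fun U => (abs_add_le _ _).trans (add_le_add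
      (by rw [abs_mul]; exact mul_le_mul_of_nonneg_left (hBb s U) (abs_nonneg a))
      (by rw [abs_mul]; exact mul_le_mul_of_nonneg_left (hBb t U) (abs_nonneg b)))⟩
    (fun U V hUV => by
      show a * B s U + b * B t U = a * B s V + b * B t V
      rw [hdep s hs hs' hUV, hdep t ht ht' hUV])
  simp only [hrefl] at h0
  rw [covLC_integral_lin_mul_lin (hint _ _) (hint _ _) (hint _ _) (hint _ _), hcov, hcov, hcov,
    hcov] at h0
  have e1 : (1 : ZMod L) - s - s = 1 - 2 * s := by ring
  have e2 : (1 : ZMod L) - t - s = 1 - s - t := by ring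
  have e3 : (1 : ZMod L) - t - t = 1 - 2 * t := by ring
  rw [e1, e2, e3] at h0
  linarith

end Hankel

/-- F4 `stub_cov_nonneg_logConvex` — **reflection positivity makes torus layer autocovariances
non-negative, even and log-convex.** For `0 ≤ β`, `S ≥ 1`, `μ` Wilson's measure on the torus
`(ℤ/(2S+1))⁴` and a bounded measurable `A` reading only time-zero SPATIAL links,
`c(n) := ∫ A · (A ∘ T_{n e₀}) dμ - (∫ A dμ)²`, `n ∈ ZMod (2S+1)`, satisfies `c(n) ≥ 0`,
`∫ A · (A ∘ T_{-n e₀}) = ∫ A · (A ∘ T_{n e₀})`, and `c(n)² ≤ c(n-1) c(n+1)` for `n ≠ 0`: stationarity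
(`covLC_integral_comp_shift_mul_comp_shift`), the layer copies `B_t := A ∘ T_{-t e₀} - ∫ A` with
`B_t ∘ Θ = B_{1-t}` (`covLC_layer_timeReflect`) reading `oPosEdges ∪ oSharedEdges` for
`1 ≤ t ≤ S + 1` (`covLC_layer_dependsOn`), Hankel positivity (`covLC_hankel_nonneg`) and the
odd-cycle bookkeeping (`covLC_bookkeeping`). [folklore] -/
theorem stub_cov_nonneg_logConvex :
    ∀ (G : Type) [Group G] [TopologicalSpace G] [IsTopologicalGroup G] [CompactSpace G]
      [MeasurableSpace G] [BorelSpace G] (r : LatticeRep G) (β : ℝ), 0 ≤ β → ∀ S : ℕ, 1 ≤ S →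
    ∀ μ : Measure (GaugeConfig 4 (2 * S + 1) G),
      μ = (wilsonMeasure r.ρ β : Measure (GaugeConfig 4 (2 * S + 1) G)) →
    ∀ A : GaugeConfig 4 (2 * S + 1) G → ℝ, Measurable A → (∃ M : ℝ, ∀ U, |A U| ≤ M) →
      DependsOn A {e : Edge 4 (2 * S + 1) | e.1 0 = 0 ∧ e.2 ≠ 0} →
    (∀ n : ZMod (2 * S + 1),
        0 ≤ ∫ U, A U * A (torusConfigShift (Pi.single (0 : Fin 4) n : Site 4 (2 * S + 1)) U) ∂μ -
          (∫ U, A U ∂μ) * ∫ U, A U ∂μ) ∧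
    (∀ n : ZMod (2 * S + 1),
        ∫ U, A U * A (torusConfigShift (Pi.single (0 : Fin 4) (-n) : Site 4 (2 * S + 1)) U) ∂μ =
          ∫ U, A U * A (torusConfigShift (Pi.single (0 : Fin 4) n : Site 4 (2 * S + 1)) U) ∂μ) ∧
    (∀ n : ZMod (2 * S + 1), n ≠ 0 →
        (∫ U, A U * A (torusConfigShift (Pi.single (0 : Fin 4) n : Site 4 (2 * S + 1)) U) ∂μ -
            (∫ U, A U ∂μ) * ∫ U, A U ∂μ) ^ 2 ≤
          (∫ U, A U * A (torusConfigShift (Pi.single (0 : Fin 4) (n - 1) : Site 4 (2 * S + 1)) U) ∂μ -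
              (∫ U, A U ∂μ) * ∫ U, A U ∂μ) *
            (∫ U, A U * A (torusConfigShift (Pi.single (0 : Fin 4) (n + 1) : Site 4 (2 * S + 1)) U) ∂μ -
              (∫ U, A U ∂μ) * ∫ U, A U ∂μ)) := by
  intro G _ _ _ _ _ _ r β hβ S hS μ hμ A hAm hAb hAd
  obtain ⟨M, hM⟩ := hAb
  set m : ℝ := ∫ U, A U ∂μ with hm
  set B : ZMod (2 * S + 1) → GaugeConfig 4 (2 * S + 1) G → ℝ := fun t U =>
    A (torusConfigShift (Pi.single (0 : Fin 4) (-t) : Site 4 (2 * S + 1)) U) - m with hB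
  set c : ZMod (2 * S + 1) → ℝ := fun n =>
    ∫ U, A U * A (torusConfigShift (Pi.single (0 : Fin 4) n : Site 4 (2 * S + 1)) U) ∂μ - m * m
    with hc
  have hII : ∀ n : ZMod (2 * S + 1),
      ∫ U, A U * A (torusConfigShift (Pi.single (0 : Fin 4) (-n) : Site 4 (2 * S + 1)) U) ∂μ =
        ∫ U, A U * A (torusConfigShift (Pi.single (0 : Fin 4) n : Site 4 (2 * S + 1)) U) ∂μ := by
    intro n
    rw [Pi.single_neg, ← covLC_integral_comp_shift_mul r.ρ β hμ A A]
    congr 1; funext U; ring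
  have heven : ∀ n, c (-n) = c n := fun n => by simp only [hc]; rw [hII]
  have hBm : ∀ t, Measurable (B t) := fun t =>
    (hAm.comp (torusConfigShift
      (Pi.single (0 : Fin 4) (-t) : Site 4 (2 * S + 1))).measurable).sub_const m
  have hBb : ∀ t U, |B t U| ≤ M + |m| := fun t U =>
    (abs_sub _ _).trans (add_le_add (hM _) le_rfl)
  have hrefl : ∀ t U, B t U.timeReflect = B (1 - t) U := fun t U => by
    simp only [hB]; rw [covLC_layer_timeReflect hAd t U]
  have hdep : ∀ t : ZMod (2 * S + 1), 1 ≤ t.val → t.val ≤ (2 * S + 1) / 2 + 1 →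
      DependsOn (B t) ((WilsonOddRP.oPosEdges ∪ WilsonOddRP.oSharedEdges :
        Finset (Edge 4 (2 * S + 1))) : Set (Edge 4 (2 * S + 1))) :=
    fun t ht ht' U V hUV => congrArg (fun x : ℝ => x - m) (covLC_layer_dependsOn hAd ht ht' hUV)
  have hcov : ∀ s t : ZMod (2 * S + 1), ∫ U, B s U * B t U ∂μ = c (s - t) := fun s t => by
    simp only [hB, hc]
    rw [covLC_integral_centred_mul_centred r.ρ β hμ r.continuous A hAm hM m hm.symm,
      ← Pi.single_sub, neg_sub_neg]
  have hH : ∀ s t : ZMod (2 * S + 1), 1 ≤ s.val → s.val ≤ S + 1 → 1 ≤ t.val → t.val ≤ S + 1 →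
      ∀ a b : ℝ, 0 ≤ a ^ 2 * c (1 - 2 * s) + 2 * a * b * c (1 - s - t) + b ^ 2 * c (1 - 2 * t) :=
    fun s t hs hs' ht ht' a b =>
      covLC_hankel_nonneg r.ρ (odd_two_mul_add_one S) (by omega) r.continuous hβ hμ B c hBm hBb
        hrefl hdep hcov hs (by omega) ht (by omega) a b
  obtain ⟨hI, hIII⟩ := covLC_bookkeeping S hS c heven hH
  exact ⟨hI, hII, hIII⟩

end Summit.QuantumFields.YangMills.Theorems.PoincareToGap

end
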